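import Summits.BirchSwinnertonDyer.BirchSwinnertonDyer.Theses.UniversalToricDescent
import Summits.BirchSwinnertonDyer.BirchSwinnertonDyer.Theorems.UniversalToricDescentTwinAlgMuZeroAtThreeOfBetaRoadParam
import Summits.BirchSwinnertonDyer.BirchSwinnertonDyer.Theorems.UniversalToricDescentResidualSelmerFinite
import Literature.NumberTheory.EllipticCurves.ZpExtensionDecompositionAbovePProofs
import Literature.NumberTheory.GaloisRepresentations.AbsGaloisGroup
import HarnessLib

/-!
# Crux 24737 `TwinAlgMuZeroAtThree` — NODE `flat_cubic_transport` (crux-ideate g4, idea `ramified-flattening-transport`)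

D-0171 node for `stmt-BirchSwinnertonDyer-24737` (NOT registered; the registered skeleton of record stays
`Lines/beta_road.lean` v19).  Thesis of the line: ONE CYCLOTOMIC STEP FLATTENS `ρ̄ = E′[3]` AT `3`.

Over `ℚ₃` the très-ramifié bucket B (`3 ∥ N′`, `n = v₃(Δ′)`, `3 ∤ n`) admits no finite-flat / good-ordinary avatar of
`ρ̄` (the route's own `UniversalToricDescentPeuRamifieMultTwinResupplyAtThree`: «for `3 ∤ n` no pencil member is
good, as it must be»), which is what walls every recorded line at its `p ∣ N` inputs (Howard Thm. B at `p ∥ N`,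
BDP/Castella at `p ∣ N`, Kriz at `a₃ = 0`).  After the cyclic cubic base change `F⁺ = ℚ(ζ₉)⁺ = ℚ(θ)`,
`θ³ − 3θ + 1 = 0` (disc `81 = 3⁴`, `3` totally ramified, `e = 3`; §0), the Tate parameter has
`v_{F⁺_v}(q) = 3n ≡ 0 (mod 3)`: `ρ̄|G_{F⁺_v}` is PEU RAMIFIÉ (Kummer class of a unit — §0
`kummer_flat_of_three_dvd_ramification`), hence finite flat with an ORDINARY Barsotti–Tate lift; by Gee–Savitt /
Gee (`p = 3` allowed: `ρ̄|G_{F⁺(ζ₃)}` irreducible for image `GL₂(𝔽₃)`) there is a Hilbert newform `h/F⁺` of parallel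
weight `2`, `v`-ORDINARY, level PRIME TO `v`, `h ≡ E′ (mod 𝔮)`.  Over the sextic CM field `M = F⁺K` every prime of
`N′/3` splits and `v` splits: the weight-2, `p ∤ level`, `p`-ordinary anticyclotomic machinery (Heegner points on the
Shimura curve `X_{B/F⁺}`, `B` ramified at two real places; Hsieh's toric `p`-adic `L`-function; Howard/Fouquet
Kolyvagin systems) is available for `h` where it is NOT for `E′`.  Residual Selmer groups are `ρ̄`-determined, so
«`μ = 0 ∧ Λ`-torsion» for `h` over the `ℚ`-descended line `F_∞ = M·K_∞^{ac}` transports to «`R(F_∞, ρ̄)` finite»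
(= S1), descends to `K_∞` (S2: a `3`-extension, finite kernel), and the tree's receptacle closes bucket B; bucket
C₀ is the registered constant C₀′ BY NAME.

PIECES (D-0171 tags; evidence and leaves in `Lines/flat_cubic_transport.md`):
* S1 `FlatCubicResidualFinite` / `stub_flatCubicResidualFinite` — the TRANSFERRED crux C⁺: `R_{𝔭′}^{Σ₀}(F_∞, E′_K[3])`
  finite for `F = K(θ)`.  UNDECIDED · EQUIV to the bucket-B half of the crux up to S2 and its converse for
  `3`-extensions (Nakayama over the local ring `𝔽₃[C₃]`) — the content is the proof strategy it unlocks upstairs.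
  Children (markdown; not typable today — no Hilbert-modular Selmer / CM-field `p`-adic-`L` vocabulary over `M`):
  L_src ATTACKABLE-from-print (Gee–Savitt arXiv:0904.0043 Thm 7.1 · Gee 2011 Cor 3.1.7; in-tree anchors
  `Literature.NumberTheory.Automorphic.Thorne2019_thm1`, `isModularEllipticCurve_baseChange_rat_of_isSolvable`) ·
  L_an «`μ(ℒ_v(h/M)|C₃-fixed line) = 0`» IDEA-NEEDED (Hsieh arXiv:1112.1580 Thm 2 assumes `p ∤ D_F`; here
  `e(v|3) = 3`) · L_alg «Howard/Fouquet divisibility for `h/M` at `p = 3`» UNDECIDED (Fouquet 2013 §1.1.2: `p > 3`) ·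
  L_sh Shapiro + residual transport over `F_∞` ATTACKABLE (tree: `finite_residualSelmer_iff_of_addEquiv`).
* S2 `CubicDescent` / `stub_cubicDescent` — WEAKER · ATTACKABLE (restriction to the index-`3` subgroup `Γ_{F_∞}`
  has finite kernel on `H¹` of a finite module and respects the unramified / strict local conditions).
* C₀′ `stub_goodSS` — the registered constant `TwinAlgMuZeroAtThreeGoodSSOfParam` BY NAME (UNDECIDED, shared
  with `beta_road` v19 and `unipotent_bipartite`).
* §0 INSTRUMENT (PROVED, no `sorry`): the flattening lever as group theory (`kummer_flat_of_three_dvd_ramification`,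
  `three_dvd_val_of_unit_mul_cube`), the arithmetic of the flattening cubic (`flatCubic_*`: Eisenstein shift at `3`,
  discriminant `3⁴`, no root mod `2`, a cube mod `3`), and `neg_one_no_fixed_vector` (`−1 ∈ ρ̄(Γ_{F_∞})` ⟹
  `H⁰(F_∞, ρ̄) = 0`).
* Composition `TwinAlgMuZeroAtThree_of : FlatCubicResidualFinite → CubicDescent → C₀′ → crux` BY NAME, real proof:
  bucket split; on B the chain S1 → S2 → `finite_selmerAc_pTorsion_of_finite_residualSelmer` (𝔭′ finitely
  decomposed: `not_decomp_le_kerSubgroup_of_isImaginaryQuadratic`; `Σ₀` = the bad places prime to `3`) →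
  `Σ₀ ↦ ∅` (`selmerAc_empty_le`) → `isTorsion_and_exists_generator_of_finite_pTorsion`.

Sorries ONLY inside `stub_*`.  References: [GeeSavitt2011 = arXiv:0904.0043, Thm 7.1/7.2] [Gee2011, Cor 3.1.7]
[Hsieh2014 = arXiv:1112.1580, Thm 1, Thm 2, Thm 6.1–6.2] [Fouquet2013 = doi:10.1112/S0010437X12000619, §1.1.2, Thm B]
[GreenbergVatsal2000, §2 p. 26] [LimSujatha2018, Prop 3.2] [HachimoriMatsuno1999, Thm 3.1] [Serre1987, §2.8]
[Edixhoven1992, §2].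
-/

set_option autoImplicit false
-- `…BirchSwinnertonDyer.BirchSwinnertonDyer…` is the cell's nested layout (D-0017)
set_option linter.dupNamespace false

/-! ## §0 INSTRUMENT — kernel-checked data behind the lever (no `sorry`; stated before `open scoped Classical`) -/

namespace Summit.BirchSwinnertonDyer.BirchSwinnertonDyer.Cruxes.TwinAlgMuZeroAtThree.FlatCubicTransport.Instrument

/-- **The flattening lever in miniature (PROVED).**  `ι : G → G'` the inclusion `K_uˣ ↪ L_wˣ` of multiplicative groups
of local fields, `v`, `v'` their normalised valuations, `v' ∘ ι = e • v` with `3 ∣ e` (ramification index divisible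
by `3`): every `x ∈ G` becomes «unit × cube» in `G'` — the Kummer class of the Tate parameter `q` becomes PEU RAMIFIÉ.
[cite: Serre1987, §2.8] [cite: Edixhoven1992, §2] -/
theorem kummer_flat_of_three_dvd_ramification {G G' : Type*} [CommGroup G] [CommGroup G']
    (ι : G →* G') (v : G →* Multiplicative ℤ) (v' : G' →* Multiplicative ℤ)
    (hv' : Function.Surjective v') (e : ℕ) (he : 3 ∣ e)
    (hcomp : ∀ x, v' (ι x) = (v x) ^ e) (x : G) :
    ∃ u y : G', v' u = 1 ∧ ι x = u * y ^ 3 := by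
  obtain ⟨k, rfl⟩ := he
  obtain ⟨z, hz⟩ := hv' ((v x) ^ k)
  refine ⟨ι x * (z ^ 3)⁻¹, z, ?_, ?_⟩
  · rw [map_mul, map_inv, map_pow, hz, hcomp, ← pow_mul, mul_comm k 3, mul_inv_cancel]
  · rw [inv_mul_cancel_right]

/-- Converse bookkeeping (PROVED): a «unit × cube» has valuation divisible by `3` — so over `ℚ₃` itself (`e = 1`,
`3 ∤ v₃(q) = n`) the class of `q` is NOT of this form: bucket B is très ramifié downstairs, peu ramifié upstairs.
[cite: Serre1987, §2.8] -/
theorem three_dvd_val_of_unit_mul_cube {G' : Type*} [CommGroup G'] (v' : G' →* Multiplicative ℤ)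
    {x u y : G'} (hu : v' u = 1) (hx : x = u * y ^ 3) :
    (3 : ℤ) ∣ Multiplicative.toAdd (v' x) := by
  subst hx
  rw [map_mul, map_pow, hu, one_mul, toAdd_pow, nsmul_eq_mul]
  exact Dvd.intro (Multiplicative.toAdd (v' y)) (by push_cast; ring)

/-- The flattening cubic `x³ − 3x + 1` (minimal polynomial of `θ = ζ₉ + ζ₉⁻¹`) is EISENSTEIN at `3` after `x = y − 1`:
irreducible over `ℚ`, and `3` is totally ramified in `ℚ(θ)` (`e = 3`). [folklore] -/
theorem flatCubic_eisenstein_shift (y : ℤ) : (y - 1) ^ 3 - 3 * (y - 1) + 1 = y ^ 3 - 3 * y ^ 2 + 3 := by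
  ring

/-- Its discriminant `−4p³ − 27q² = 81 = 3⁴` is a square: `ℚ(θ)/ℚ` is cyclic cubic, ramified only at `3`
(`= ℚ(ζ₉)⁺`, the first layer of the cyclotomic `ℤ₃`-extension of `ℚ`). [folklore] -/
theorem flatCubic_disc : -4 * (-3 : ℤ) ^ 3 - 27 * (1 : ℤ) ^ 2 = 3 ^ 4 := by norm_num

/-- No root modulo `2` (a second irreducibility certificate: `2` is inert in `ℚ(θ)`). [folklore] -/
theorem flatCubic_no_root_mod_two : ∀ x : ZMod 2, x ^ 3 - 3 * x + 1 ≠ 0 := by decide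

/-- A perfect cube modulo `3`: `x³ − 3x + 1 ≡ (x + 1)³ (mod 3)` (total ramification at `3` seen residually). [folklore] -/
theorem flatCubic_cube_mod_three : ∀ x : ZMod 3, x ^ 3 - 3 * x + 1 = (x + 1) ^ 3 := by decide

/-- The other two roots are polynomials in `θ` (so `ℚ(θ)`, `K(θ)` are GALOIS, cyclic cubic): over any commutative ring,
`x³ − 3x + 1 = (x − θ)(x − (θ² − 2))(x − (2 − θ − θ²))` whenever `θ³ − 3θ + 1 = 0`. [folklore] -/
theorem flatCubic_split {R : Type*} [CommRing R] (θ : R) (hθ : θ ^ 3 - 3 * θ + 1 = 0) (x : R) :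
    x ^ 3 - 3 * x + 1 = (x - θ) * (x - (θ ^ 2 - 2)) * (x - (2 - θ - θ ^ 2)) := by
  linear_combination (x * (θ + 1) - θ ^ 2 - θ + 1) * hθ

/-- `−1 ∈ ρ̄(Γ_{F_∞})` (the image over `F_∞` is still `GL₂(𝔽₃)`: `F/K` is Galois and `GL₂(𝔽₃)` has no NORMAL subgroup
of index `3`; `K_∞ F/F` is pro-`3` and `GL₂(𝔽₃)` has no quotient of order `3`) ⟹ `H⁰(F_∞, ρ̄) = 0`: `−1` fixes no
non-zero vector of `𝔽₃²` (decidable). [folklore] -/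
theorem neg_one_no_fixed_vector :
    ∀ w : Fin 2 → ZMod 3, (-1 : Matrix (Fin 2) (Fin 2) (ZMod 3)).mulVec w = w → w = 0 := by decide

end Summit.BirchSwinnertonDyer.BirchSwinnertonDyer.Cruxes.TwinAlgMuZeroAtThree.FlatCubicTransport.Instrument

noncomputable section

open scoped Classical NumberField

namespace Summit.BirchSwinnertonDyer.BirchSwinnertonDyer.Cruxes.TwinAlgMuZeroAtThree.FlatCubicTransport

open NumberField IsDedekindDomain Field WeierstrassCurve
open Literature.NumberTheory.EllipticCurves Literature.NumberTheory.EllipticCurves.GreenbergSelmer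
  Literature.NumberTheory.EllipticCurves.GreenbergVatsal2000 Literature.NumberTheory.EllipticCurves.IwasawaAlgebra
open Summit.BirchSwinnertonDyer.Rank1Residual.X11b Summit.BirchSwinnertonDyer.Rank1Residual.X11b.AcSelmer
open Summit.BirchSwinnertonDyer.BirchSwinnertonDyer.Theorems.UniversalToricDescentAcDualMuZero
open Summit.BirchSwinnertonDyer.BirchSwinnertonDyer.Theorems
open Summit.BirchSwinnertonDyer.BirchSwinnertonDyer.Theorems.UniversalToricDescentResidualSelmerFinite
open Literature.NumberTheory.EllipticCurves.ZpExtension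
open Literature.NumberTheory.EllipticCurves.ModularForms (ModularParametrizationData)

/-! ## §1 Objects of the line -/

/-- `Γ_{F_∞} ≤ Γ_K` for `F = K(θ)` and `F_∞ = F·K_∞`: the normal core of the absolute Galois group of `K(θ)` (pulled
back along the tree's `absoluteGaloisGroup.toAlgEquiv`; `K(θ)/K` is Galois by `flatCubic_split`, so the core IS
`Γ_{K(θ)}` — taking it makes normality automatic; an `abbrev` so that the `Normal` instance is found) intersected with `Gal(K̄/K_∞) = ker κ`.  Intended `θ³ − 3θ + 1 = 0`:
`F = K·ℚ(ζ₉)⁺`, cyclic cubic over `K`, `3` totally ramified. [cite: GreenbergVatsal2000, §2 (Selmer groups over `K̄^H`)] -/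
abbrev flatLine {K : Type} [Field K] [NumberField K] (κ : ZpExtension K 3) (θ : AlgebraicClosure K) :
    Subgroup (absoluteGaloisGroup K) :=
  ((IntermediateField.adjoin K ({θ} : Set (AlgebraicClosure K))).fixingSubgroup.comap
      (absoluteGaloisGroup.toAlgEquiv K).toMonoidHom).normalCore ⊓ κ.kerSubgroup

/-- `Σ₀(W)` = the finite places of `K` prime to `3` where `W` has bad reduction (for `W = E′_K`: the primes above `N′/3`).
[cite: GreenbergVatsal2000, §2 (non-primitive Selmer groups)] -/
def badAwayThree {K : Type} [Field K] [NumberField K] (W : WeierstrassCurve K) : Set (HeightOneSpectrum (𝓞 K)) :=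
  {v | ((3 : ℕ) : 𝓞 K) ∉ v.asIdeal ∧ ¬ W.HasGoodReductionAt v}

/-! ## §2 The statements of the line (as constants) and the stubs -/

/-- **S1 (UNDECIDED; the transferred crux C⁺ — EQUIV to the bucket-B half up to S2 and Nakayama over `𝔽₃[C₃]`).**
For the twin `W′` in bucket B (`3 ∥ N′`, très ramifié, `ρ̄₃` onto, conductor `N′`, a modular parametrisation datum at
level `N′`), `K` imaginary quadratic Heegner for `N′` with odd `d_K`, `κ` anticyclotomic, `𝔭′ ∋ 3`, and `θ` a root of
`x³ − 3x + 1`: the residual (`𝔭′`-strict, relaxed at the other prime above `3`, unramified outside `Σ₀ ∪ {3}`)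
Selmer group of `E′_K[3]` over `F_∞ = K(θ)·K_∞` is FINITE.  Strategy = children L_src · L_an · L_alg · L_sh (module
docstring): `ρ̄|G_{F⁺_v}` is peu ramifié (§0), so a `v`-ordinary Barsotti–Tate Hilbert newform `h ≡ E′ (mod 𝔮)` of
level prime to `v` exists over `F⁺ = ℚ(θ)`; «`μ = 0 ∧ torsion`» for `X_{∅,0}(h/F_∞)` transports residually to this.
[cite: GeeSavitt2011, Thm 7.1] [cite: Hsieh2014, Thm 2 (shape; `p ∤ D_F` there)] [cite: GreenbergVatsal2000, §2 p. 26] -/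
@[conjecture]
def FlatCubicResidualFinite : Prop :=
    ∀ (W' : WeierstrassCurve ℚ) [W'.IsElliptic] [W'.IsGloballyMinimal] (N' : ℕ) [NeZero N']
      (K : Type) [Field K] [NumberField K] (_Dt' : ModularParametrizationData W' N'),
      Rank1Residual.Mult W' 3 → ¬ 3 ∣ padicValInt 3 W'.minimalDiscriminantInt →
      W'.HasSurjectiveModNGaloisRep 3 → W'.conductorNorm ℤ = N' → IsImaginaryQuadratic K →
      SatisfiesHeegnerHypothesis N' K → Odd (NumberField.discr K) →
      ∀ (κ : ZpExtension K 3), κ.IsAnticyclotomic →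
      ∀ (𝔭' : HeightOneSpectrum (𝓞 K)), ((3 : ℕ) : 𝓞 K) ∈ 𝔭'.asIdeal →
      ∀ (θ : AlgebraicClosure K), θ ^ 3 - 3 * θ + 1 = 0 →
        (datumStrictSelmer (flatLine κ θ) ((W'.baseChange K).geomTorsion ((3 : ℕ) : ℤ)) 3
            (AcSelmer.bdpData _ 3 𝔭') (badAwayThree (W'.baseChange K)) :
          Set (subgroupH1 (flatLine κ θ) ((W'.baseChange K).geomTorsion ((3 : ℕ) : ℤ)))).Finite

/-- **S2 (WEAKER · ATTACKABLE; cubic descent).**  For any `W/K`, `ℤ₃`-extension `κ`, `𝔭′`, `Σ` and root `θ`: if the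
residual Selmer group of `W[3]` over `F_∞ = K(θ)·K_∞` is finite then so is the one over `K_∞`.  Sketch: restriction
`H¹(ker κ, W[3]) → H¹(Γ_{F_∞}, W[3])` has kernel `H¹(ker κ/Γ_{F_∞}, W[3]^{Γ_{F_∞}})` — finite (index `≤ 3`, finite
module) — and maps the `K_∞`-conditions into the `F_∞`-conditions (inertia subgroups intersected with `Γ_{F_∞}`, same
strict kernel at `𝔭′`). [cite: GreenbergVatsal2000, §2 p. 26] [cite: LimSujatha2018, §3] -/
@[conjecture]
def CubicDescent : Prop :=
    ∀ (K : Type) [Field K] [NumberField K] (W : WeierstrassCurve K) (κ : ZpExtension K 3)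
      (𝔭' : HeightOneSpectrum (𝓞 K)) (S : Set (HeightOneSpectrum (𝓞 K))) (θ : AlgebraicClosure K),
      θ ^ 3 - 3 * θ + 1 = 0 →
        (datumStrictSelmer (flatLine κ θ) (W.geomTorsion ((3 : ℕ) : ℤ)) 3 (AcSelmer.bdpData _ 3 𝔭') S :
            Set (subgroupH1 (flatLine κ θ) (W.geomTorsion ((3 : ℕ) : ℤ)))).Finite →
        (datumStrictSelmer κ.kerSubgroup (W.geomTorsion ((3 : ℕ) : ℤ)) 3 (AcSelmer.bdpData _ 3 𝔭') S :
            Set (subgroupH1 κ.kerSubgroup (W.geomTorsion ((3 : ℕ) : ℤ)))).Finite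

/-- Stub S1 (UNDECIDED · EQUIV-up-to-S2; RESEARCH). [cite: GeeSavitt2011, Thm 7.1] [cite: Hsieh2014, Thm 2 (shape)] -/
theorem stub_flatCubicResidualFinite : FlatCubicResidualFinite := by
  sorry

/-- Stub S2 (WEAKER · ATTACKABLE; Galois cohomology of a finite module). [cite: GreenbergVatsal2000, §2 p. 26] -/
theorem stub_cubicDescent : CubicDescent := by
  sorry

/-- **C₀′ (UNDECIDED; shared) — the registered constant `TwinAlgMuZeroAtThreeGoodSSOfParam` BY NAME** (bucket C₀,
good supersingular `a₃ = 0`; not touched by this line: the unramified-quadratic flattening makes `ρ̄|G_v` reducible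
but non-parallel nearly-ordinary weights carry no Heegner points). [cite: Howard2004HeegnerKolyvagin, Thm. B (shape only)] -/
theorem stub_goodSS : UniversalToricDescentBetaRoadParamDefs.TwinAlgMuZeroAtThreeGoodSSOfParam := by
  sorry

/-! ## §3 Glue (real proofs) -/

/-- A root of the flattening cubic exists in `K̄`. [folklore] -/
theorem exists_flatCubic_root (K : Type) [Field K] [NumberField K] :
    ∃ θ : AlgebraicClosure K, θ ^ 3 - 3 * θ + 1 = 0 := by
  let f : Polynomial (AlgebraicClosure K) := Polynomial.X ^ 3 - Polynomial.C 3 * Polynomial.X + 1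
  have hf : f.natDegree = 3 := by
    simp only [f]
    compute_degree!
  have hf0 : f ≠ 0 := by
    rintro h
    rw [h, Polynomial.natDegree_zero] at hf
    exact absurd hf (by norm_num)
  have hdeg : f.degree ≠ 0 := by
    rw [Polynomial.degree_eq_natDegree hf0, hf]
    exact_mod_cast (by norm_num : (3 : ℕ) ≠ 0)
  obtain ⟨θ, hθ⟩ := IsAlgClosed.exists_root f hdeg
  refine ⟨θ, ?_⟩
  have h := hθ.eq_zero
  simpa [f] using h

/-- **Bucket B of the crux from S1 and S2** (the chain of the module docstring; real proof).
[cite: GreenbergVatsal2000, §2 p. 26] [cite: LimSujatha2018, Prop 3.2] -/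
theorem twinAlgMuZeroAtThree_mult_of_flatCubic (h1 : FlatCubicResidualFinite) (h2 : CubicDescent)
    (W' : WeierstrassCurve ℚ) [W'.IsElliptic] [W'.IsGloballyMinimal] (N' : ℕ) [NeZero N']
    (K : Type) [Field K] [NumberField K] (Dt' : ModularParametrizationData W' N')
    (hm : Rank1Residual.Mult W' 3) (htr : ¬ 3 ∣ padicValInt 3 W'.minimalDiscriminantInt)
    (hsurj : W'.HasSurjectiveModNGaloisRep 3) (hN : W'.conductorNorm ℤ = N') (hK : IsImaginaryQuadratic K)
    (hH : SatisfiesHeegnerHypothesis N' K) (hodd : Odd (NumberField.discr K))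
    (κ : ZpExtension K 3) (hκ : κ.IsAnticyclotomic)
    (γ : absoluteGaloisGroup K) [Fact (κ.IsTopGenerator γ)]
    (𝔭' : HeightOneSpectrum (𝓞 K)) (h𝔭' : ((3 : ℕ) : 𝓞 K) ∈ 𝔭'.asIdeal) :
    Module.IsTorsion (IwasawaAlgebra 3) (XAc (W'.baseChange K) 3 κ 𝔭' ∅ γ) ∧
      ∃ g' : UnrSeries 3,
        (XAc.charIdeal (W'.baseChange K) 3 κ 𝔭' ∅ γ).map (PowerSeries.map (Halves.toUnr 3)) =
            Ideal.span {g'} ∧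
          ∃ i : ℕ, ‖((PowerSeries.coeff i g' : unrIntegers 3) : ℂ_[3])‖ = 1 := by
  haveI : (W'.baseChange K).IsElliptic := by rw [WeierstrassCurve.baseChange]; infer_instance
  obtain ⟨θ, hθ⟩ := exists_flatCubic_root K
  -- S1: residual finiteness over `F_∞ = K(θ)·K_∞`
  have hF := h1 W' N' K Dt' hm htr hsurj hN hK hH hodd κ hκ 𝔭' h𝔭' θ hθ
  -- S2: descent to `K_∞`
  have hR := h2 K (W'.baseChange K) κ 𝔭' (badAwayThree (W'.baseChange K)) θ hθ hF
  -- `𝔭′` is finitely decomposed in `K_∞`; `Σ₀` contains the bad places prime to `3`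
  have hdec : ¬ (decomp 𝔭' ≤ κ.kerSubgroup) := not_decomp_le_kerSubgroup_of_isImaginaryQuadratic hK κ h𝔭'
  have hS : ∀ v : HeightOneSpectrum (𝓞 K), v ∉ badAwayThree (W'.baseChange K) →
      ((3 : ℕ) : 𝓞 K) ∉ v.asIdeal → (W'.baseChange K).HasGoodReductionAt v := by
    intro v hv h3
    by_contra hbad
    exact hv ⟨h3, hbad⟩
  -- residual finiteness ⟹ `Sel_{𝔭′}^{Σ₀}(K_∞, E′[3^∞])[3]` finite (tree)
  have hSel : Set.Finite {s : selmerAc (W'.baseChange K) 3 κ 𝔭' (badAwayThree (W'.baseChange K)) | 3 • s = 0} :=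
    finite_selmerAc_pTorsion_of_finite_residualSelmer (W'.baseChange K) κ h𝔭' hdec hS hR
  -- `Σ₀ ↦ ∅` (along the injective inclusion `Sel^∅ ≤ Sel^{Σ₀}`, `selmerAc_empty_le`)
  have hfin : Set.Finite {s : selmerAc (W'.baseChange K) 3 κ 𝔭' ∅ | 3 • s = 0} := by
    have hle : selmerAc (W'.baseChange K) 3 κ 𝔭' ∅ ≤
        selmerAc (W'.baseChange K) 3 κ 𝔭' (badAwayThree (W'.baseChange K)) := selmerAc_empty_le
    have hι : Function.Injective (AddSubgroup.inclusion hle) := AddSubgroup.inclusion_injective hle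
    refine (hSel.preimage hι.injOn).subset ?_
    intro s hs
    simp only [Set.mem_setOf_eq, Set.mem_preimage] at hs ⊢
    rw [← map_nsmul, hs, map_zero]
  -- the landed receptacle
  exact isTorsion_and_exists_generator_of_finite_pTorsion (W'.baseChange K) 3 κ 𝔭' ∅ γ Set.finite_empty hfin

/-! ## §4 The crux BY NAME -/

/-- **Crux 24737 `TwinAlgMuZeroAtThree` BY NAME from S1, S2 and C₀′** (bucket split; B by
`twinAlgMuZeroAtThree_mult_of_flatCubic`, C₀ by the constant).  CONDITIONAL on the three stubs; 24737 stays OPEN.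
[cite: GreenbergVatsal2000, §2 p. 26] [cite: Howard2004HeegnerKolyvagin, Thm. B (shape only)] -/
theorem TwinAlgMuZeroAtThree_of :
    FlatCubicResidualFinite → CubicDescent →
      UniversalToricDescentBetaRoadParamDefs.TwinAlgMuZeroAtThreeGoodSSOfParam →
        Summit.BirchSwinnertonDyer.BirchSwinnertonDyer.Theses.UniversalToricDescent.TwinAlgMuZeroAtThree := by
  intro h1 h2 hC0 W' _ _ N' _ K _ _ Dt' hbucket hsurj hN hK hH hodd κ hκ γ _ 𝔭 h𝔭 he hf 𝔭' h𝔭' hne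
  rcases hbucket with ⟨hm, htr⟩ | ⟨hss, ha⟩
  · exact twinAlgMuZeroAtThree_mult_of_flatCubic h1 h2 W' N' K Dt' hm htr hsurj hN hK hH hodd κ hκ γ 𝔭' h𝔭'
  · exact (UniversalToricDescentBetaRoadParamDefs.twinAlgMuZeroAtThreeGoodSSOfParam_iff.mp hC0)
      W' N' K Dt' hss ha hsurj hN hK hH hodd κ hκ γ 𝔭 h𝔭 he hf 𝔭' h𝔭' hne

/-- The same, fed by the node's own stubs (sorries live only in `stub_*`). -/
theorem twinAlgMuZeroAtThree_of_stubs :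
    Summit.BirchSwinnertonDyer.BirchSwinnertonDyer.Theses.UniversalToricDescent.TwinAlgMuZeroAtThree :=
  TwinAlgMuZeroAtThree_of stub_flatCubicResidualFinite stub_cubicDescent stub_goodSS

end Summit.BirchSwinnertonDyer.BirchSwinnertonDyer.Cruxes.TwinAlgMuZeroAtThree.FlatCubicTransport

end
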